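import Literature.Barriers.CriticalPhenomena.WeaklySAWPerturbativeBetaA1
import Literature.Barriers.CriticalPhenomena.WeaklySAWCouplingFlowRemainderCutoff
import Literature.Barriers.CriticalPhenomena.WeaklySAWFourDimLogCorrectionsBubble
import HarnessLib

/-!
# BBS 2015, Lemma 8.3.2, display (e:ginfty) for the EXPLICIT `β`: `ǧ_∞ ∼ 1/𝖡_{m²}` as
# `(m²,g₀) → (0,ĝ₀)`, for every perturbed flow `ǧ_{j+1} = ǧ_j - β_j(m²)ǧ_j² + r_j`, `r_j = O(χ_jǧ_j³)`

Companion of `WeaklySAWCouplingFlowRemainderCutoff.lean` (the second lemma of §8.3 of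
Bauerschmidt–Brydges–Slade, CMP 337 (2015), arXiv:1403.7422, for an ABSTRACT sequence `β`
satisfying Assumption (A1): `tendsto_limUnder_mul_tsum_of_cutoff`, "`ǧ_∞ · Σ_jβ_j → 1`"), of
`WeaklySAWPerturbativeBeta.lean` (Lemma 8.3.1: `Σ_jβ_j(m²) = 𝖡_{m²}` for the explicit `β`), of
`WeaklySAWPerturbativeBetaA1.lean` (Assumption (A1) HOLDS for the explicit `β`, uniformly in
`m² ∈ [0,δ]`) and of `WeaklySAWFourDimLogCorrectionsBubble.lean` ((1.8): `𝖡_{m²} ∼ 𝖻 log m⁻²`, so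
`𝖡_{m²} → ∞`). Source, §8.3, Lemma 8.3.2 and its proof: "the limit `ǧ_∞ = lim_{j→∞}ǧ_j` exists …
It remains to prove (e:ginfty) … `ǧ_∞⁻¹ + O(|log ǧ_∞|) = g₀⁻¹ + 𝖡_{m²}`. In particular `ǧ_∞ → 0` as
`m² ↓ 0` … Finally, (ginfty) follows", (e:ginfty) being the input "`ǧ_∞ ∼ 1/𝖡_{m²}` as
`(m²,g₀) → (0,ĝ₀)`" of §8.4 (the field `Sec84Data.gInf_asymp` of
`WeaklySAWFourDimLogCorrectionsTheorem41.lean`).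

## What this file proves (everything; no definition, no named fact)

* `tendsto_freeBubble_four_atTop` — `𝖡_{m²} → ∞` as `m² ↓ 0` (from (1.8));
* `jOmega_ne_top_of_summable` — under (A1), a summable `β` has a finite `Ω`-scale `j_Ω`;
* **`tendsto_limUnder_mul_freeBubble`** — (e:ginfty) for the explicit `β_j(m²) = betaPT 4 L m² j`
  (`L ≥ 2`, `Ω > 1`): for every remainder constant `R ≥ 0` there is `δ > 0` such that for EVERY family
  of perturbed flows `ǧ(m²,g₀)` (`GchHyp (β(m²)) ρ ǧ B g₀`, any `B`) indexed by
  `(m²,g₀) ∈ (0,δ)²`, with remainders `ρ_l ≤ Rχ_l(m²)ǧ_l` (`χ_l = Ω^{-(l-j_Ω(m²))₊}`, i.e.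
  `r_l = O(χ_lǧ_l³)`), `ǧ_∞(m²,g₀)·𝖡_{m²} → 1` as `(m²,g₀) → (0,ĝ₀)` within `(0,δ)²`, for every
  `ĝ₀ ∈ (0,δ)` — the existence of the flow (Proposition 8.2) being the only remaining input.
-/

noncomputable section

open Set Filter Topology
open Literature.Probability.LatticeModels
open scoped BigOperators

namespace Literature.Barriers.CriticalPhenomena

namespace CTWSAW

open LongRangePhi4 LongRangePhi4.FRD

/-! ### `𝖡_{m²} → ∞` -/

/-- **`𝖡_{m²} → ∞` as `m² ↓ 0`** (`d = 4`), from (1.8) `𝖡_{m²} ∼ 𝖻 log m⁻²`.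
[cite: BauerschmidtBrydgesSlade2015LogCorr, eq. (1.8)] -/
theorem tendsto_freeBubble_four_atTop : Tendsto (fun m2 : ℝ => freeBubble 4 m2) (𝓝[>] 0) atTop := by
  have h18 : Tendsto (fun m2 : ℝ => freeBubble 4 m2 / (freeBubbleB * Real.log m2⁻¹)) (𝓝[>] 0) (𝓝 1) :=
    BBS2015_eq18_holds
  have hb : 0 < freeBubbleB := by unfold freeBubbleB; positivity
  have hlog : Tendsto (fun m2 : ℝ => freeBubbleB * Real.log m2⁻¹) (𝓝[>] 0) atTop :=
    (Real.tendsto_log_atTop.comp tendsto_inv_nhdsGT_zero).const_mul_atTop hb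
  have hprod := h18.pos_mul_atTop one_pos hlog
  refine hprod.congr' ?_
  filter_upwards [hlog.eventually (eventually_gt_atTop 0)] with m2 hm
  exact div_mul_cancel₀ _ hm.ne'

/-! ### A summable `β` has a finite `Ω`-scale -/

/-- Under Assumption (A1), a summable `β` (so `β_j → 0`) has `j_Ω < ∞`: otherwise `β_j ≥ c > 0` for
all but finitely many `j`. [cite: BauerschmidtBrydgesSlade2015LogCorr, §6.1 (Assumption (A1); "for m² > 0 … β_j decays extremely rapidly to 0 for j ≥ j_m")] -/
theorem jOmega_ne_top_of_summable {β : ℕ → ℝ} {Ω B c : ℝ} (hA : HypA1 β Ω B c) (hs : Summable β) :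
    jOmega β Ω ≠ ⊤ := by
  intro htop
  obtain ⟨s, -, hexc⟩ := hA.exc
  have h0 := hs.tendsto_atTop_zero
  have hev : ∀ᶠ j in atTop, β j < c := h0.eventually (gt_mem_nhds hA.c_pos)
  obtain ⟨J, hJ⟩ := eventually_atTop.1 hev
  -- a scale beyond the exceptional set and beyond `J`
  set j : ℕ := max J (s.sup id + 1) with hj
  have hjs : j ∉ s := by
    intro hmem
    have : j ≤ s.sup id := Finset.le_sup (f := id) hmem
    omega
  have h1 := hexc j (by rw [htop]; exact le_top) hjs
  have h2 := hJ j (le_max_left _ _)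
  linarith

/-! ### (e:ginfty) for the explicit `β` -/

/-- **BBS 2015, Lemma 8.3.2, (e:ginfty) for the explicit `β`, PROVED modulo the existence of the
flow**: for `L ≥ 2`, `Ω > 1` and every `R ≥ 0` there is `δ > 0` such that for every family of
perturbed flows `ǧ(m²,g₀)` of `ǧ_{j+1} = ǧ_j - β_j(m²)ǧ_j² + r_j` (`GchHyp`, with
`β_j(m²) = betaPT 4 L m² j`) indexed by `(m²,g₀) ∈ (0,δ)²`, with `r_l = O(χ_lǧ_l³)` in the form
`ρ_l ≤ Rχ_l(m²)ǧ_l`, and every `ĝ₀ ∈ (0,δ)`: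
`lim_jǧ_j(m²,g₀) · 𝖡_{m²} → 1` as `(m²,g₀) → (0,ĝ₀)` in `(0,δ)²`. Ingredients: (A1) for the
explicit `β` (`hypA1_betaPT`) hence Lemma 2.1 of the flow paper below `g₁(Ω,B,c)`
(`HypA1.cutoffGbarHyp`), `Σ_jβ_j(m²) = 𝖡_{m²}` (Lemma 8.3.1), `𝖡_{m²} → ∞` ((1.8)), and the abstract
`tendsto_limUnder_mul_tsum_of_cutoff`.
[cite: BauerschmidtBrydgesSlade2015LogCorr, Lemma 8.3.2 (display (e:ginfty): ǧ_∞ ∼ 1/𝖡_{m²} as (m²,g₀) → (0,ĝ₀))] -/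
theorem tendsto_limUnder_mul_freeBubble {L : ℝ} (hL : 2 ≤ L) {Ω : ℝ} (hΩ : 1 < Ω) {R : ℝ}
    (hR : 0 ≤ R) :
    ∃ δ : ℝ, 0 < δ ∧ ∀ (ρ g : ℝ × ℝ → ℕ → ℝ) (Bg : ℝ),
      (∀ p ∈ Ioo (0 : ℝ) δ ×ˢ Ioo (0 : ℝ) δ, GchHyp (betaPT 4 L p.1) (ρ p) (g p) Bg p.2) →
      (∀ p ∈ Ioo (0 : ℝ) δ ×ˢ Ioo (0 : ℝ) δ, ∀ l, ρ p l ≤ R * chi (betaPT 4 L p.1) Ω l * g p l) →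
      ∀ ĝ₀ ∈ Ioo (0 : ℝ) δ,
        Tendsto (fun p : ℝ × ℝ => limUnder atTop (g p) * freeBubble 4 p.1)
          (𝓝[Ioo 0 δ ×ˢ Ioo 0 δ] (0, ĝ₀)) (𝓝 1) := by
  have hL1 : (1 : ℝ) < L := by linarith
  obtain ⟨δ₁, B, c, hδ₁, hδ₁1, hA1⟩ := hypA1_betaPT hL hΩ
  have hA0 : HypA1 (betaPT 4 L 0) Ω B c := hA1 0 le_rfl hδ₁.le
  have hBnn : 0 ≤ B := hA0.B_nonneg
  have hc : 0 < c := hA0.c_pos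
  have hthr : 0 < gbarThreshold Ω B c := gbarThreshold_pos hΩ hBnn
  set δ : ℝ := min δ₁ (min (gbarThreshold Ω B c) (c / (24 * (R + 1)))) with hδdef
  have hδ0 : 0 < δ := lt_min hδ₁ (lt_min hthr (by positivity))
  have hδ₁le : δ ≤ δ₁ := min_le_left _ _
  have hδthr : δ ≤ gbarThreshold Ω B c := (min_le_right _ _).trans (min_le_left _ _)
  have hδc : δ ≤ c / (24 * (R + 1)) := (min_le_right _ _).trans (min_le_right _ _)
  refine ⟨δ, hδ0, fun ρ g Bg hG hρ ĝ₀ hĝ₀ => ?_⟩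
  set S : Set (ℝ × ℝ) := Ioo (0 : ℝ) δ ×ˢ Ioo (0 : ℝ) δ with hSdef
  -- per-point data on `S`
  have hA : ∀ p ∈ S, HypA1 (betaPT 4 L p.1) Ω B c := fun p hp =>
    hA1 p.1 hp.1.1.le (hp.1.2.le.trans hδ₁le)
  have hsum : ∀ p ∈ S, Summable (betaPT 4 L p.1) := fun p hp =>
    summable_betaPT (d := 4) (by norm_num) hL1 hp.1.1
  have hfin : ∀ p ∈ S, jOmega (betaPT 4 L p.1) Ω ≠ ⊤ := fun p hp =>
    jOmega_ne_top_of_summable (hA p hp) (hsum p hp)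
  -- the finite cut-offs
  set k : ℝ × ℝ → ℕ := fun p => (jOmega (betaPT 4 L p.1) Ω).toNat with hkdef
  have hk : ∀ p ∈ S, jOmega (betaPT 4 L p.1) Ω = (k p : ℕ∞) := fun p hp =>
    (ENat.coe_toNat (hfin p hp)).symm
  have hcut : ∀ p ∈ S, CutoffGbarHyp (betaPT 4 L p.1) Ω (k p : ℕ∞) B c ⌊c⁻¹⌋₊ p.2 := by
    intro p hp
    have := (hA p hp).cutoffGbarHyp hΩ hp.2.1 (hp.2.2.le.trans hδthr)
    rwa [hk p hp] at this
  have hsmall : ∀ p ∈ S, R * p.2 ≤ c / 24 := by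
    intro p hp
    have h1 : R * p.2 ≤ R * δ := mul_le_mul_of_nonneg_left hp.2.2.le hR
    have h2 : R * δ ≤ R * (c / (24 * (R + 1))) := mul_le_mul_of_nonneg_left hδc hR
    have h3 : R * (c / (24 * (R + 1))) ≤ c / 24 := by
      rw [mul_div_assoc', div_le_div_iff₀ (by positivity) (by positivity)]
      nlinarith
    linarith
  have hρ' : ∀ p ∈ S, ∀ l, ρ p l ≤ R * cutoffWeight Ω (k p : ℕ∞) l * g p l := by
    intro p hp l
    have := hρ p hp l
    rwa [chi, hk p hp] at this
  -- `Σ_jβ_j(m²) = 𝖡_{m²} → ∞` along the filter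
  have htsum : ∀ p ∈ S, ∑' j, betaPT 4 L p.1 j = freeBubble 4 p.1 := fun p hp =>
    (hasSum_betaPT (d := 4) (by norm_num) hL1 hp.1.1).tsum_eq
  have hfst : Tendsto (fun p : ℝ × ℝ => p.1) (𝓝[S] (0, ĝ₀)) (𝓝[>] 0) := by
    refine tendsto_nhdsWithin_iff.2 ⟨?_, ?_⟩
    · exact (continuous_fst.tendsto ((0 : ℝ), ĝ₀)).mono_left nhdsWithin_le_nhds
    · filter_upwards [self_mem_nhdsWithin] with p hp using hp.1.1
  have hSlim : Tendsto (fun p : ℝ × ℝ => ∑' j, betaPT 4 L p.1 j) (𝓝[S] (0, ĝ₀)) atTop := by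
    refine (tendsto_freeBubble_four_atTop.comp hfst).congr' ?_
    filter_upwards [self_mem_nhdsWithin] with p hp using (htsum p hp).symm
  have hsnd : Tendsto (fun p : ℝ × ℝ => p.2) (𝓝[S] (0, ĝ₀)) (𝓝 ĝ₀) :=
    (continuous_snd.tendsto ((0 : ℝ), ĝ₀)).mono_left nhdsWithin_le_nhds
  -- pass to the subtype `S` to apply the abstract lemma
  set F : Filter (ℝ × ℝ) := 𝓝[S] (0, ĝ₀) with hF
  have hrange : range (Subtype.val : S → ℝ × ℝ) ∈ F := by
    rw [Subtype.range_coe]; exact self_mem_nhdsWithin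
  have key := tendsto_limUnder_mul_tsum_of_cutoff (ι := S) (l := comap Subtype.val F)
    (βf := fun i => betaPT 4 L i.1.1) (ρf := fun i => ρ i.1) (gf := fun i => g i.1)
    (k := fun i => k i.1) (B := Bg) (B' := B) (c := c) (R := R) (Ω := Ω) (N := ⌊c⁻¹⌋₊)
    (g0 := fun i => i.1.2) (ĝ₀ := ĝ₀)
    (fun i => hG i.1 i.2) (fun i => hcut i.1 i.2) hR (fun i => hsmall i.1 i.2)
    (fun i l => hρ' i.1 i.2 l) (fun i => hsum i.1 i.2) (hSlim.comp tendsto_comap)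
    (hsnd.comp tendsto_comap) hĝ₀.1
  have key' : Tendsto ((fun p : ℝ × ℝ => limUnder atTop (g p) * ∑' j, betaPT 4 L p.1 j) ∘
      (Subtype.val : S → ℝ × ℝ)) (comap Subtype.val F) (𝓝 1) := key
  rw [tendsto_comap'_iff hrange] at key'
  refine key'.congr' ?_
  filter_upwards [self_mem_nhdsWithin] with p hp
  simp only [htsum p hp]

end CTWSAW

end Literature.Barriers.CriticalPhenomena
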